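import Mathlib.AlgebraicGeometry.AffineTransitionLimit
import Mathlib.CategoryTheory.Filtered.Final
import Literature.AlgebraicGeometry.Motives.EtaleToProetSections
import HarnessLib

/-!
# Bhatt–Scholze Lemma 5.1.1, presheaf half proved: `(Lan F)(lim U_i) = colim F(U_i)`; the lemma
# reduced to "sheafification does not change `Lan F` on pro-étale affines"

Bhatt–Scholze prove Lemma 5.1.1 ("for `F ∈ Shv(X_ét)` and `U ∈ X_proét^aff` with a presentation
`U = lim_i U_i`, one has `ν*F(U) = colim_i F(U_i)`", vendored as
`nonempty_isColimit_sectionsCocone_etaleToProetPullback` in `EtaleToProetSections.lean`) in two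
steps (arXiv p. 29): "The pullback `F'` of `F` to `S` as a presheaf is given by
`F'(B) = colim F(B_i)`. It thus suffices to check that `F'` is a sheaf". This file **proves the
first step** on Mathlib's carriers and isolates the second as the residual named fact:

* **Step A, proved** (`ProetAffinePresentation.isColimitLanCocone`): for a presentation
  `W = lim_i U_i` (`ProetAffinePresentation`, Def. 4.2.1) and any abelian presheaf `G` on `X_ét`,
  the canonical cocone `G(U_i) → (Lan G)(U_i) → (Lan G)(W)` exhibits the value at `W` of the left
  Kan extension `Lan G` along `X_ét ⊂ X_proét` (the presheaf inverse image) as `colim_i G(U_i)`.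
  Proof: `(Lan G)(W)` is the colimit of `G(V)` over all `X`-morphisms `W → V`, `V ∈ X_ét`
  (pointwise Kan extension), and `i ↦ (U_i, π_i)` is a final functor into that index category
  (`ProetAffinePresentation.final_costructuredArrow`), because every `X`-morphism from
  `W = lim_i U_i` to an étale — hence locally finitely presented — `X`-scheme `V` factors through
  some `U_i`, uniquely up to passing to a smaller `U_j` (EGA IV 8.13.1 / Stacks 01ZC, in Mathlib as
  `Scheme.preservesColimit_yoneda`: `Hom_X(lim U_i, V) = colim Hom_X(U_i, V)` for cofiltered limits
  of qcqs `X`-schemes with affine transition maps).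
* **The comparison** `θ_W : (Lan F)(W) → ν*F(W)` (`lanToPullbackApp`: the sheafification map at `W`
  followed by the identification of `ν*` with `(Lan –)^#`), through which the legs of the sections
  cocone of Lemma 5.1.1 factor (`ProetAffinePresentation.sectionsCocone_ι_app_eq`,
  `unit_app_hom_app_eq`).
* **The residual named fact** (`isIso_toSheafify_lan_app_of_presentation`, statement only, D-0014):
  for `W` with a presentation, the sheafification map `(Lan F)(W) → (Lan F)^#(W) = ν*F(W)` is an
  isomorphism — Bhatt–Scholze's "it suffices to check that `F'` is a sheaf" (with Lemma 4.2.4: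
  pro-étale affines generate `X_proét`, Thm. 2.3.4).
* **Lemma 5.1.1 ⇔ the residual fact, proved** (`ProetAffinePresentation.isColimitSectionsCocone`,
  `ProetAffinePresentation.isIso_toSheafify_app`,
  `nonempty_isColimit_sectionsCocone_etaleToProetPullback_iff`), and the re-based chain: the residual
  fact implies `full_faithful_etaleToProetPullback` (Lemma 5.1.2) and, with Milne VI 2.8 and the
  acyclicity of `ν*I`, `finite_proetCohomology_zmod_of_isProper`
  (`finite_proetCohomology_zmod_of_isProper_of_toSheafify`).

## References

* B. Bhatt, P. Scholze, *The pro-étale topology for schemes*, Astérisque 369 (2015)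
  (arXiv:1309.1198, held; arXiv pages): Def. 4.2.1 (p. 24), Lemma 4.2.4 (p. 24), Lemma 5.1.1 and
  its proof, Lemma 5.1.2 (p. 29). [BhattScholze2015]
* The Stacks Project, Tag 01ZC (limits of schemes: morphisms from `lim S_i` into a scheme locally
  of finite presentation), the reference of Mathlib's `Scheme.preservesColimit_yoneda`
  (= EGA IV 8.13.1). [StacksProject]

## Design notes

* Everything is stated for `Ab.{u+1}`-valued (pre)sheaves, the coefficients of
  `etaleToProetPullback`; Step A holds verbatim for any coefficient category with the relevant
  colimits, only the abelian case is recorded.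
* `rw` is unusable in most goals of this file (morphisms of `X.ProEt`/`X.Etale` are not
  type-correct at instances transparency in this Mathlib), hence the term-mode equational proofs.
* Mathlib searches: `Scheme.preservesColimit_yoneda`, `Scheme.exists_π_app_comp_eq_of_locallyOfFinitePresentation`,
  `Functor.final_of_exists_of_isFiltered`, `Functor.Final.isColimitWhiskerEquiv`,
  `Functor.isPointwiseLeftKanExtensionLeftKanExtensionUnit`; no computation of `Functor.lan` or
  `Functor.sheafPullback` on limits of representables exists in Mathlib. Nothing restated.
-/

universe u

open CategoryTheory Limits Opposite AlgebraicGeometry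

noncomputable section

namespace Literature.AlgebraicGeometry.Motives

/-! ### Step A: `(Lan G)(lim U_i) = colim G(U_i)` -/

section StepA

variable {X : Scheme.{u}} {W : X.ProEt} (𝔭 : ProetAffinePresentation X W)

/-- The cone condition of a presentation: `π_i ≫ U_a = π_j` for `a : i → j`. [folklore] -/
theorem ProetAffinePresentation.π_comp {i j : 𝔭.ι} (a : i ⟶ j) :
    𝔭.π.app i ≫ (etaleToProet X).map (𝔭.diagram.map a) = 𝔭.π.app j :=
  (𝔭.π.naturality a).symm.trans (Category.id_comp _)

/-- **`i ↦ (U_i, π_i : W → U_i)`**, the functor from `ιᵒᵖ` to the index category of the pointwise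
left Kan extension at `W` (costructured arrows of `(etaleToProet X).op` over `op W`, i.e. pairs
`(V ∈ X_ét, W → V)`). [cite: BhattScholze2015, Lemma 5.1.1 (proof)] -/
def ProetAffinePresentation.costructuredArrow :
    𝔭.ιᵒᵖ ⥤ CostructuredArrow (etaleToProet X).op (op W) where
  obj i := CostructuredArrow.mk (𝔭.π.app i.unop).op
  map {i j} a := CostructuredArrow.homMk (𝔭.diagram.map a.unop).op
    (congrArg Quiver.Hom.op (𝔭.π_comp a.unop))
  map_id i := by
    ext
    simp
  map_comp a b := by
    ext
    simp

/-- Each `U_i` is affine. [cite: BhattScholze2015, Def. 4.2.1] -/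
instance ProetAffinePresentation.isAffine_diagram_obj_left (i : 𝔭.ι) :
    IsAffine (𝔭.diagram.obj i).left :=
  𝔭.isAffine i

/-- Each `U_i` is affine (as an `X`-scheme). [cite: BhattScholze2015, Def. 4.2.1] -/
instance ProetAffinePresentation.isAffine_forget_obj_left (i : 𝔭.ι) :
    IsAffine ((𝔭.diagram ⋙ Scheme.Etale.forget X).obj i).left :=
  𝔭.isAffine i

/-- Each `U_i` is quasi-compact. [folklore] -/
instance ProetAffinePresentation.compactSpace_forget_obj_left (i : 𝔭.ι) :
    CompactSpace ((𝔭.diagram ⋙ Scheme.Etale.forget X).obj i).left :=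
  inferInstance

/-- Each `U_i` is quasi-separated. [folklore] -/
instance ProetAffinePresentation.quasiSeparatedSpace_forget_obj_left (i : 𝔭.ι) :
    QuasiSeparatedSpace ((𝔭.diagram ⋙ Scheme.Etale.forget X).obj i).left :=
  inferInstance

/-- The transition maps `U_i → U_j` are affine (morphisms between affine schemes). [folklore] -/
instance ProetAffinePresentation.isAffineHom_forget_map_left {i j : 𝔭.ι} (a : i ⟶ j) :
    IsAffineHom ((𝔭.diagram ⋙ Scheme.Etale.forget X).map a).left :=
  inferInstanceAs (IsAffineHom (𝔭.diagram.map a).left)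

/-- The cone `W → U_i` of `X`-schemes. [cite: BhattScholze2015, Def. 4.2.1] -/
def ProetAffinePresentation.overCone : Cone (𝔭.diagram ⋙ Scheme.Etale.forget X) :=
  (Scheme.ProEt.forget X).mapCone (Cone.mk W 𝔭.π)

/-- It is a limit cone (the defining property of a presentation). [cite: BhattScholze2015, Def. 4.2.1] -/
def ProetAffinePresentation.isLimitOverCone : IsLimit 𝔭.overCone :=
  𝔭.isLimit

/-- **`Hom_X(W, V) = colim_i Hom_X(U_i, V)`** for `V ∈ X_ét`, as a colimit of sets: EGA IV 8.13.1 /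
Stacks 01ZC for the cofiltered limit `W = lim_i U_i` of affine `X`-schemes and the locally finitely
presented `X`-scheme `V` (Mathlib `Scheme.preservesColimit_yoneda`). [cite: StacksProject, Tag 01ZC] -/
def ProetAffinePresentation.isColimitYoneda (V : X.Etale) :
    IsColimit ((yoneda.obj ((Scheme.Etale.forget X).obj V)).mapCocone 𝔭.overCone.op) :=
  haveI : Etale ((Scheme.Etale.forget X).obj V).hom := V.prop
  haveI : LocallyOfFinitePresentation ((Scheme.Etale.forget X).obj V).hom := inferInstance
  haveI := Scheme.preservesColimit_yoneda (𝔭.diagram ⋙ Scheme.Etale.forget X)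
    ((Scheme.Etale.forget X).obj V)
  isColimitOfPreserves (yoneda.obj ((Scheme.Etale.forget X).obj V)) 𝔭.isLimitOverCone.op

/-- **Every `X`-morphism `W → V` to `V ∈ X_ét` factors through some projection `W → U_i`.**
[cite: StacksProject, Tag 01ZC] -/
theorem ProetAffinePresentation.exists_fac (V : X.Etale) (φ : W ⟶ (etaleToProet X).obj V) :
    ∃ (i : 𝔭.ι) (g : 𝔭.diagram.obj i ⟶ V), 𝔭.π.app i ≫ (etaleToProet X).map g = φ := by
  obtain ⟨j, y, hy⟩ := Types.jointly_surjective_of_isColimit (𝔭.isColimitYoneda V)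
    ((Scheme.ProEt.forget X).map φ)
  refine ⟨j.unop, (Scheme.Etale.forget X).preimage y, (Scheme.ProEt.forget X).map_injective ?_⟩
  rw [Functor.map_comp]
  change (Scheme.ProEt.forget X).map (𝔭.π.app j.unop) ≫
    (Scheme.Etale.forget X).map ((Scheme.Etale.forget X).preimage y) = _
  rw [Functor.map_preimage]
  exact hy

/-- **Two factorizations through `U_i` of the same `X`-morphism `W → V` agree on some `U_j → U_i`.**
[cite: StacksProject, Tag 01ZC] -/
theorem ProetAffinePresentation.exists_comp_eq (V : X.Etale) {i : 𝔭.ι}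
    (g g' : 𝔭.diagram.obj i ⟶ V)
    (h : 𝔭.π.app i ≫ (etaleToProet X).map g = 𝔭.π.app i ≫ (etaleToProet X).map g') :
    ∃ (j : 𝔭.ι) (a : j ⟶ i), 𝔭.diagram.map a ≫ g = 𝔭.diagram.map a ≫ g' := by
  have := (Types.FilteredColimit.isColimit_eq_iff' (𝔭.isColimitYoneda V) (i := op i)
    ((Scheme.Etale.forget X).map g) ((Scheme.Etale.forget X).map g')).1 (by
      change (Scheme.ProEt.forget X).map (𝔭.π.app i) ≫ (Scheme.Etale.forget X).map g =
        (Scheme.ProEt.forget X).map (𝔭.π.app i) ≫ (Scheme.Etale.forget X).map g'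
      exact congrArg (Scheme.ProEt.forget X).map h)
  obtain ⟨j, f, hf⟩ := this
  refine ⟨j.unop, f.unop, (Scheme.Etale.forget X).map_injective ?_⟩
  exact ((Scheme.Etale.forget X).map_comp _ _).trans
    (hf.trans ((Scheme.Etale.forget X).map_comp _ _).symm)

/-- **`i ↦ (U_i, π_i)` is final** in the category of pairs `(V ∈ X_ét, W → V)` (Mathlib
`Functor.final_of_exists_of_isFiltered`: `ιᵒᵖ` is filtered, every `W → V` factors through some
`U_i`, and two factorizations are equalized by some `U_j → U_i`). [cite: BhattScholze2015, Lemma 5.1.1 (proof)] -/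
instance ProetAffinePresentation.final_costructuredArrow : 𝔭.costructuredArrow.Final := by
  refine Functor.final_of_exists_of_isFiltered _ (fun d => ?_) (fun {d i} s s' => ?_)
  · obtain ⟨i, g, hg⟩ := 𝔭.exists_fac d.left.unop d.hom.unop
    exact ⟨op i, ⟨CostructuredArrow.homMk g.op (congrArg Quiver.Hom.op hg)⟩⟩
  · have hs := CostructuredArrow.w s
    have hs' := CostructuredArrow.w s'
    obtain ⟨j, a, ha⟩ := 𝔭.exists_comp_eq d.left.unop s.left.unop s'.left.unop
      ((congrArg Quiver.Hom.unop hs).trans (congrArg Quiver.Hom.unop hs').symm)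
    refine ⟨op j, a.op, ?_⟩
    ext
    exact congrArg Quiver.Hom.op ha

/-- **The canonical cocone `G(U_i) → (Lan G)(U_i) → (Lan G)(W)`** under the presheaf inverse image
`Lan G` (left Kan extension along `etaleToProet X`): the pointwise colimit cocone of `Lan G` at `W`
restricted along `i ↦ (U_i, π_i)`. [cite: BhattScholze2015, Lemma 5.1.1 (proof)] -/
def ProetAffinePresentation.lanCocone (G : (X.Etale)ᵒᵖ ⥤ Ab.{u + 1}) :
    Cocone (𝔭.diagram.op ⋙ G) :=
  ((Functor.LeftExtension.mk _ ((etaleToProet X).op.leftKanExtensionUnit G)).coconeAt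
    (op W)).whisker 𝔭.costructuredArrow

/-- The legs of `𝔭.lanCocone G` (by `rfl`). [folklore] -/
theorem ProetAffinePresentation.lanCocone_ι_app (G : (X.Etale)ᵒᵖ ⥤ Ab.{u + 1}) (i : 𝔭.ιᵒᵖ) :
    (𝔭.lanCocone G).ι.app i =
      ((etaleToProet X).op.lanUnit.app G).app (op (𝔭.diagram.obj i.unop)) ≫
        ((etaleToProet X).op.lan.obj G).map (𝔭.π.app i.unop).op :=
  rfl

/-- **Step A of Bhatt–Scholze Lemma 5.1.1, proved: `(Lan G)(W) = colim_i G(U_i)`** for every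
presentation `W = lim_i U_i` and every abelian presheaf `G` on `X_ét` ("The pullback `F'` of `F` to
`S` as a presheaf is given by `F'(B) = colim F(B_i)`"): the pointwise left Kan extension is the
colimit over all `(V, W → V)`, and `i ↦ (U_i, π_i)` is final there
(`final_costructuredArrow`, Stacks 01ZC). [cite: BhattScholze2015, Lemma 5.1.1 (proof)]
[cite: StacksProject, Tag 01ZC] -/
def ProetAffinePresentation.isColimitLanCocone (G : (X.Etale)ᵒᵖ ⥤ Ab.{u + 1}) :
    IsColimit (𝔭.lanCocone G) :=
  (Functor.Final.isColimitWhiskerEquiv 𝔭.costructuredArrow _).symm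
    (Functor.isPointwiseLeftKanExtensionLeftKanExtensionUnit (etaleToProet X).op G (op W))

end StepA

/-! ### The comparison `θ_W : (Lan F)(W) → ν*F(W)` -/

section Theta

variable (X : Scheme.{u})

/-- The components of `e⁻¹ : (Lan –)^# ≅ ν*` are isomorphisms. [folklore] -/
theorem isIso_etaleToProetPullbackIso_inv_app_hom_app (F : Sheaf X.smallEtaleTopology Ab.{u + 1})
    (V : (X.ProEt)ᵒᵖ) : IsIso (((etaleToProetPullbackIso X).inv.app F).hom.app V) :=
  (((sheafToPresheaf _ _).mapIso ((etaleToProetPullbackIso X).app F)).app V).isIso_inv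

/-- **`θ_W : (Lan F)(W) → ν*F(W)`**: the sheafification map `(Lan F)(W) → (Lan F)^#(W)` followed by
the component at `W` of `(Lan –)^# ≅ ν*` (`etaleToProetPullbackIso`). Its invertibility for `W` a
pro-étale affine is the content of Lemma 5.1.1 beyond Step A. [cite: BhattScholze2015, Lemma 5.1.1] -/
def lanToPullbackApp (F : Sheaf X.smallEtaleTopology Ab.{u + 1}) (W : X.ProEt) :
    ((etaleToProet X).op.lan.obj F.obj).obj (op W) ⟶
      ((etaleToProetPullback X).obj F).obj.obj (op W) :=
  (toSheafify (Scheme.ProEt.topology X) ((etaleToProet X).op.lan.obj F.obj)).app (op W) ≫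
    ((etaleToProetPullbackIso X).inv.app F).hom.app (op W)

/-- **`η_F(U) = (F(U) → (Lan F)(U)) ≫ θ_U`**: the unit of `ν* ⊣ ν_*` at `U ∈ X_ét` is the Kan
extension unit followed by `θ_U` (from `η ≫ ν_*(e) = η'` and `η' = lanUnit ≫ toSheafify`,
`EtaleToProetSections.lean`). [folklore] -/
theorem unit_app_hom_app_eq (F : Sheaf X.smallEtaleTopology Ab.{u + 1}) (U : X.Etale) :
    ((etaleToProetAdjunction X).unit.app F).hom.app (op U) =
      ((etaleToProet X).op.lanUnit.app F.obj).app (op U) ≫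
        lanToPullbackApp X F ((etaleToProet X).obj U) := by
  have hA : ((etaleToProetAdjunction X).unit.app F).hom.app (op U) ≫
      ((etaleToProetPullbackIso X).hom.app F).hom.app (op ((etaleToProet X).obj U)) =
        ((etaleToProetAdjunction' X).unit.app F).hom.app (op U) :=
    congrArg (fun f => f.hom.app (op U)) (etaleToProetAdjunction_unit_app X F)
  have hB : ((etaleToProetAdjunction' X).unit.app F).hom.app (op U) =
      ((etaleToProet X).op.lanUnit.app F.obj).app (op U) ≫
        (toSheafify (Scheme.ProEt.topology X) ((etaleToProet X).op.lan.obj F.obj)).app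
          (op ((etaleToProet X).obj U)) :=
    congrArg (fun f => f.app (op U)) (etaleToProetAdjunction'_unit_app_hom X F)
  have hC : ((etaleToProetPullbackIso X).hom.app F).hom.app (op ((etaleToProet X).obj U)) ≫
      ((etaleToProetPullbackIso X).inv.app F).hom.app (op ((etaleToProet X).obj U)) = 𝟙 _ :=
    congrArg (fun f => f.hom.app (op ((etaleToProet X).obj U)))
      ((etaleToProetPullbackIso X).hom_inv_id_app F)
  refine (Category.comp_id _).symm.trans ?_
  refine (congrArg (fun t => ((etaleToProetAdjunction X).unit.app F).hom.app (op U) ≫ t)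
    hC.symm).trans ?_
  refine (Category.assoc _ _ _).symm.trans ?_
  refine (congrArg (· ≫ ((etaleToProetPullbackIso X).inv.app F).hom.app
    (op ((etaleToProet X).obj U))) hA).trans ?_
  refine (congrArg (· ≫ ((etaleToProetPullbackIso X).inv.app F).hom.app
    (op ((etaleToProet X).obj U))) hB).trans ?_
  exact Category.assoc _ _ _

variable {X} {W : X.ProEt} (𝔭 : ProetAffinePresentation X W)

/-- **The legs of the sections cocone of Lemma 5.1.1 factor through `θ_W`**:
`(F(U_i) →η ν*F(U_i) → ν*F(W)) = (F(U_i) → (Lan F)(U_i) → (Lan F)(W)) ≫ θ_W` (naturality of the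
sheafification map and of `e⁻¹` along `π_i : W → U_i`). [cite: BhattScholze2015, Lemma 5.1.1 (proof)] -/
theorem ProetAffinePresentation.sectionsCocone_ι_app_eq (F : Sheaf X.smallEtaleTopology Ab.{u + 1})
    (i : 𝔭.ιᵒᵖ) :
    (𝔭.sectionsCocone F).ι.app i = (𝔭.lanCocone F.obj).ι.app i ≫ lanToPullbackApp X F W := by
  have hN1 : ((etaleToProetPullbackIso X).inv.app F).hom.app (op ((etaleToProet X).obj
      (𝔭.diagram.obj i.unop))) ≫ ((etaleToProetPullback X).obj F).obj.map (𝔭.π.app i.unop).op =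
      ((etaleToProetPullback' X).obj F).obj.map (𝔭.π.app i.unop).op ≫
        ((etaleToProetPullbackIso X).inv.app F).hom.app (op W) :=
    (((etaleToProetPullbackIso X).inv.app F).hom.naturality (𝔭.π.app i.unop).op).symm
  have hN2 : (toSheafify (Scheme.ProEt.topology X) ((etaleToProet X).op.lan.obj F.obj)).app
      (op ((etaleToProet X).obj (𝔭.diagram.obj i.unop))) ≫
        ((etaleToProetPullback' X).obj F).obj.map (𝔭.π.app i.unop).op =
      ((etaleToProet X).op.lan.obj F.obj).map (𝔭.π.app i.unop).op ≫
        (toSheafify (Scheme.ProEt.topology X) ((etaleToProet X).op.lan.obj F.obj)).app (op W) :=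
    ((toSheafify (Scheme.ProEt.topology X)
      ((etaleToProet X).op.lan.obj F.obj)).naturality (𝔭.π.app i.unop).op).symm
  refine (congrArg (· ≫ ((etaleToProetPullback X).obj F).obj.map (𝔭.π.app i.unop).op)
    (unit_app_hom_app_eq X F (𝔭.diagram.obj i.unop))).trans ?_
  refine (Category.assoc _ _ _).trans ?_
  change ((etaleToProet X).op.lanUnit.app F.obj).app (op (𝔭.diagram.obj i.unop)) ≫
      (((toSheafify (Scheme.ProEt.topology X) ((etaleToProet X).op.lan.obj F.obj)).app
        (op ((etaleToProet X).obj (𝔭.diagram.obj i.unop))) ≫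
        ((etaleToProetPullbackIso X).inv.app F).hom.app (op ((etaleToProet X).obj
          (𝔭.diagram.obj i.unop)))) ≫
        ((etaleToProetPullback X).obj F).obj.map (𝔭.π.app i.unop).op) =
    (((etaleToProet X).op.lanUnit.app F.obj).app (op (𝔭.diagram.obj i.unop)) ≫
      ((etaleToProet X).op.lan.obj F.obj).map (𝔭.π.app i.unop).op) ≫
      ((toSheafify (Scheme.ProEt.topology X) ((etaleToProet X).op.lan.obj F.obj)).app (op W) ≫
        ((etaleToProetPullbackIso X).inv.app F).hom.app (op W))
  refine (congrArg (fun t => ((etaleToProet X).op.lanUnit.app F.obj).app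
    (op (𝔭.diagram.obj i.unop)) ≫ t) (Category.assoc _ _ _)).trans ?_
  refine (congrArg (fun t => ((etaleToProet X).op.lanUnit.app F.obj).app
    (op (𝔭.diagram.obj i.unop)) ≫ ((toSheafify (Scheme.ProEt.topology X)
      ((etaleToProet X).op.lan.obj F.obj)).app
        (op ((etaleToProet X).obj (𝔭.diagram.obj i.unop))) ≫ t)) hN1).trans ?_
  refine (congrArg (fun t => ((etaleToProet X).op.lanUnit.app F.obj).app
    (op (𝔭.diagram.obj i.unop)) ≫ t) (Category.assoc _ _ _).symm).trans ?_
  refine (congrArg (fun t => ((etaleToProet X).op.lanUnit.app F.obj).app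
    (op (𝔭.diagram.obj i.unop)) ≫ (t ≫ ((etaleToProetPullbackIso X).inv.app F).hom.app (op W)))
      hN2).trans ?_
  refine (congrArg (fun t => ((etaleToProet X).op.lanUnit.app F.obj).app
    (op (𝔭.diagram.obj i.unop)) ≫ t) (Category.assoc _ _ _)).trans ?_
  exact (Category.assoc _ _ _).symm

/-- `θ_W` is an isomorphism as soon as the sheafification map at `W` is. [folklore] -/
theorem isIso_lanToPullbackApp (F : Sheaf X.smallEtaleTopology Ab.{u + 1}) (W : X.ProEt)
    [IsIso ((toSheafify (Scheme.ProEt.topology X) ((etaleToProet X).op.lan.obj F.obj)).app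
      (op W))] :
    IsIso (lanToPullbackApp X F W) :=
  @IsIso.comp_isIso _ _ _ _ _ _ _ ‹_› (isIso_etaleToProetPullbackIso_inv_app_hom_app X F (op W))

end Theta

/-! ### Lemma 5.1.1 ⇔ "sheafification does not change `Lan F` on pro-étale affines" -/

/-- **The residual content of Bhatt–Scholze Lemma 5.1.1** (named fact, statement only): for every
`W ∈ X_proét` with a presentation `W = lim_i U_i` (Def. 4.2.1) and every abelian étale sheaf `F`,
the sheafification map `(Lan F)(W) → (Lan F)^#(W) = ν*F(W)` of the presheaf inverse image
`Lan F` (left Kan extension along `X_ét ⊂ X_proét`) is an isomorphism at `W` — i.e. on pro-étale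
affines the presheaf pullback already has the values of the sheaf pullback. This is the second
step of the printed proof of Lemma 5.1.1: "The pullback `F'` of `F` to `S` as a presheaf is given
by `F'(B) = colim F(B_i)` [Step A, `ProetAffinePresentation.isColimitLanCocone`]. It thus suffices
to check that `F'` is a sheaf", done there for `X = Spec A` affine on the equivalent site `S` of
ind-étale `A`-algebras with faithfully flat covers (Thm. 2.3.4, Lemma 4.2.4: pro-étale affines
generate `X_proét`; Lemma 4.2.6: Zariski descent plus descent along a faithfully flat ind-étale
`B → C = colim C_j`, by étale descent for `F` and exactness of filtered colimits). Given Step A it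
is *equivalent* to Lemma 5.1.1 as printed (`nonempty_isColimit_sectionsCocone_etaleToProetPullback_iff`).
Read on Mathlib's carriers: `Lan = (etaleToProet X).op.lan` on `Ab.{u+1}`-valued presheaves,
sheafification for `ProEt.topology X` (no cardinal cut-off, Remark 4.1.2).
[cite: BhattScholze2015, Lemma 5.1.1 (proof) and Lemma 4.2.4] -/
def isIso_toSheafify_lan_app_of_presentation : Prop :=
  ∀ (X : Scheme.{u}) (W : X.ProEt) (_ : ProetAffinePresentation X W)
    (F : Sheaf X.smallEtaleTopology Ab.{u + 1}),
    IsIso ((toSheafify (Scheme.ProEt.topology X) ((etaleToProet X).op.lan.obj F.obj)).app (op W))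

section Equivalence

variable {X : Scheme.{u}} {W : X.ProEt} (𝔭 : ProetAffinePresentation X W)

/-- **Residual fact ⇒ Lemma 5.1.1 for `𝔭`**: if the sheafification map at `W` is an isomorphism,
the sections cocone `F(U_i) → ν*F(W)` is a colimit — it is Step A's colimit cocone followed by the
isomorphism `θ_W`. [cite: BhattScholze2015, Lemma 5.1.1] -/
def ProetAffinePresentation.isColimitSectionsCocone (F : Sheaf X.smallEtaleTopology Ab.{u + 1})
    [IsIso ((toSheafify (Scheme.ProEt.topology X) ((etaleToProet X).op.lan.obj F.obj)).app
      (op W))] :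
    IsColimit (𝔭.sectionsCocone F) :=
  (𝔭.isColimitLanCocone F.obj).ofIsoColimit
    (Cocone.ext (@asIso _ _ _ _ (lanToPullbackApp X F W) (isIso_lanToPullbackApp F W))
      fun i => (𝔭.sectionsCocone_ι_app_eq F i).symm)

/-- **Lemma 5.1.1 for `𝔭` ⇒ residual fact**: if the sections cocone is a colimit then, both it and
Step A's cocone being colimits of the same diagram compatibly with `θ_W`, `θ_W` is the canonical
isomorphism between the two colimit points, so the sheafification map at `W` is an isomorphism.
[cite: BhattScholze2015, Lemma 5.1.1] -/
theorem ProetAffinePresentation.isIso_toSheafify_app (F : Sheaf X.smallEtaleTopology Ab.{u + 1})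
    (h : IsColimit (𝔭.sectionsCocone F)) :
    IsIso ((toSheafify (Scheme.ProEt.topology X) ((etaleToProet X).op.lan.obj F.obj)).app
      (op W)) := by
  have hθ : lanToPullbackApp X F W =
      ((𝔭.isColimitLanCocone F.obj).coconePointUniqueUpToIso h).hom :=
    (𝔭.isColimitLanCocone F.obj).hom_ext fun i =>
      (𝔭.sectionsCocone_ι_app_eq F i).symm.trans
        ((𝔭.isColimitLanCocone F.obj).comp_coconePointUniqueUpToIso_hom h i).symm
  have hiso : IsIso (lanToPullbackApp X F W) := hθ ▸ inferInstance
  exact @IsIso.of_isIso_comp_right _ _ _ _ _ _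
    (((etaleToProetPullbackIso X).inv.app F).hom.app (op W))
    (isIso_etaleToProetPullbackIso_inv_app_hom_app X F (op W)) hiso

end Equivalence

/-- **Bhatt–Scholze Lemma 5.1.1 from its residual content** (Step A being proved).
[cite: BhattScholze2015, Lemma 5.1.1] -/
theorem nonempty_isColimit_sectionsCocone_etaleToProetPullback_of_toSheafify
    (h : isIso_toSheafify_lan_app_of_presentation.{u}) :
    nonempty_isColimit_sectionsCocone_etaleToProetPullback.{u} := fun X W 𝔭 F =>
  haveI := h X W 𝔭 F
  ⟨𝔭.isColimitSectionsCocone F⟩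

/-- **Lemma 5.1.1 as printed is equivalent to its residual content**, Step A being proved.
[cite: BhattScholze2015, Lemma 5.1.1] -/
theorem nonempty_isColimit_sectionsCocone_etaleToProetPullback_iff :
    nonempty_isColimit_sectionsCocone_etaleToProetPullback.{u} ↔
      isIso_toSheafify_lan_app_of_presentation.{u} :=
  ⟨fun h X W 𝔭 F => (h X W 𝔭 F).elim fun hc => 𝔭.isIso_toSheafify_app F hc,
    nonempty_isColimit_sectionsCocone_etaleToProetPullback_of_toSheafify⟩

/-- **Lemma 5.1.2 (`ν*` fully faithful) from the residual content of Lemma 5.1.1.**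
[cite: BhattScholze2015, Lemma 5.1.2] -/
theorem full_faithful_etaleToProetPullback_of_toSheafify
    (h : isIso_toSheafify_lan_app_of_presentation.{u}) :
    full_faithful_etaleToProetPullback.{u} :=
  full_faithful_etaleToProetPullback_of_sections
    (nonempty_isColimit_sectionsCocone_etaleToProetPullback_of_toSheafify h)

/-- The bridge fact `nonempty_addEquiv_proetCohomology_etaleCohomology` from the residual content of
Lemma 5.1.1 and the acyclicity of `ν*I`. [cite: BhattScholze2015, Cor. 5.1.6] -/
theorem nonempty_addEquiv_proetCohomology_etaleCohomology_of_toSheafify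
    (h : isIso_toSheafify_lan_app_of_presentation.{u})
    (hc : ∀ (X : Scheme.{u}) (I : Sheaf X.smallEtaleTopology Ab.{u}), Injective I →
      ∀ p : ℕ, Subsingleton (((etaleToProetPullbackULift X).obj I).H (p + 1))) :
    nonempty_addEquiv_proetCohomology_etaleCohomology.{u} :=
  nonempty_addEquiv_proetCohomology_etaleCohomology_of_sections
    (nonempty_isColimit_sectionsCocone_etaleToProetPullback_of_toSheafify h) hc

/-- **`finite_proetCohomology_zmod_of_isProper` from Milne VI Cor. 2.8, the residual content of
Bhatt–Scholze Lemma 5.1.1 and the acyclicity of `ν*I`** — the current trust base of the pro-étale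
finiteness fact: {`finite_etaleCohomology_of_isProper`, `isIso_toSheafify_lan_app_of_presentation`,
the acyclicity hypothesis `hc` (proof of Cor. 5.1.6; formerly the named fact
`subsingleton_sheafH_etaleToProetPullback_injective`, merged back into Cor. 5.1.6 under D-0026 and
spelled out verbatim)}; proved around them: the morphism of sites,
exactness and faithfulness of `ν*`, `(Lan F)(lim U_i) = colim F(U_i)`, Lemma 5.1.1 ⇒ 5.1.2,
`ν* ∘ const = const`, the constant-sheaf identifications and the dimension shifting.
[cite: Milne2025, VI Cor. 2.8] [cite: BhattScholze2015, Lemma 5.1.1 and Cor. 5.1.6] -/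
theorem finite_proetCohomology_zmod_of_isProper_of_toSheafify
    (h₂ : finite_etaleCohomology_of_isProper.{u})
    (h : isIso_toSheafify_lan_app_of_presentation.{u})
    (hc : ∀ (X : Scheme.{u}) (I : Sheaf X.smallEtaleTopology Ab.{u}), Injective I →
      ∀ p : ℕ, Subsingleton (((etaleToProetPullbackULift X).obj I).H (p + 1))) :
    finite_proetCohomology_zmod_of_isProper.{u} :=
  finite_proetCohomology_zmod_of_isProper_of_sections h₂
    (nonempty_isColimit_sectionsCocone_etaleToProetPullback_of_toSheafify h) hc

end Literature.AlgebraicGeometry.Motives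

end
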